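import Literature.MathematicalPhysics.QuantumFieldTheory.Chatterjee2026YMHiggs.ProcaFieldMass
import Mathlib.MeasureTheory.Integral.IntegralEqImproper
import Mathlib.Analysis.SpecialFunctions.ImproperIntegrals
import Mathlib.Analysis.Real.Pi.Bounds
import HarnessLib

/-!
# Chatterjee's pointwise bound on the Proca/free kernel `K_λ` (Lemma 4.1) — proved

S. Chatterjee, *A scaling limit of `SU(2)` lattice Yang–Mills–Higgs theory*, Probab. Math. Phys.
**7** (2026) 339–381, arXiv:2401.10507 [Chatterjee2026YMHiggs], §4.1 **Lemma 4.1**: the kernel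
`K_λ(x) = ∫₀^∞ (4πt)^{−d/2} exp(−‖x‖²/(4t) − λt) dt` of (2.1) — with `λ = m²` the free covariance
kernel `K_m(x) = ∫₀^∞ e^{−m²t} p_t(x) dt` of the tree (`OSAxiomsFreeFieldKernelProofs`,
`heatKernel`) — satisfies `K_λ(x) ≤ C(d) e^{−‖x‖√λ/2} ‖x‖^{−(d−2)}` (`d ≥ 3`),
`≤ C e^{−‖x‖√λ/4}(1 + λ⁻¹)` (`d = 2`, `‖x‖ ≥ 2√λ`), `≤ C e^{−‖x‖√λ/4}(λ⁻¹ + log(2√λ/‖x‖))`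
(`d = 2`, `‖x‖ < 2√λ`), for all `x ≠ 0`. This file DISCHARGES the named fact
`Chatterjee2026YMHiggs.kernelK_upperBound` of `ProcaFieldMass` (D-0014):

* `kernelK_le_of_three_le` : the `d ≥ 3` clause, with the constant
  `C(d) = ∫₀^∞ (4πu)^{−d/2} e^{−1/(8u)} du` (finite for `d ≥ 3`, `integrableOn_refKernel`);
* `kernelK_le_of_finrank_eq_two` : the two `d = 2` clauses, with constant `1`;
* `kernelK_upperBound_holds : kernelK_upperBound E`.

The proof is the printed one. `d ≥ 3`: AM–GM in the exponent, `m²t + ‖x‖²/(8t) ≥ ‖x‖m/2`, so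
that `e^{−m²t} p_t(x) ≤ e^{−‖x‖m/2} (4πt)^{−d/2} e^{−‖x‖²/(8t)}` (`expHeatKernel_le`), followed by
the change of variables `t = ‖x‖² u` (Mathlib `integral_comp_mul_left_Ioi`), which scales the
remaining integral to `‖x‖^{2−d} C(d)` (print substitutes `s = ‖x‖²/(4t)` and evaluates a Gamma
integral; the scaling substitution gives the same power of `‖x‖` without evaluating the
constant). `d = 2`: AM–GM with half the mass term kept ("by an application of the AM–GM inequality
similar to the above"), `e^{−m²t} p_t(x) ≤ e^{−‖x‖m/2}(4π)⁻¹ (t + ‖x‖²/8)⁻¹ e^{−m²t/2}`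
(`expHeatKernel_le_two`, using also `t⁻¹e^{−a/t} ≤ (t + a)⁻¹`), and the printed splitting of the
`t`-integral into a bounded and a logarithmic part, here at `t = 1`:
`∫₀^∞ (t + a)⁻¹ e^{−bt} dt ≤ log(1 + 1/a) + 1/b` (`integral_inv_add_mul_exp_le`), giving
`K ≤ e^{−‖x‖m/2}(4π)⁻¹(log(1 + 8/‖x‖²) + 2/m²)`, from which both printed `d = 2` bounds follow
(`log(1 + 8/r²) ≤ 8/r² ≤ 2/m²` for `r ≥ 2m`; `1 + 8/r² ≤ (1 + 8/m²)(2m/r)²` for `r < 2m`) — with the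
better decay `e^{−‖x‖m/2} ≤ e^{−‖x‖m/4}`. Theorems only; no new definitions, no new named facts.
-/

noncomputable section

open MeasureTheory Set Filter
open Literature.Analysis.UnboundedOperators

namespace Literature.MathematicalPhysics.QuantumFieldTheory.Chatterjee2026YMHiggs

/-! ### AM–GM in the exponent -/

/-- AM–GM: `‖x‖ m/2 ≤ m² t + ‖x‖²/(8t)` for `t > 0` (`8m²t² − 4rmt + r² = 8(mt − r/4)² + r²/2 ≥ 0`).
[folklore] -/
private theorem half_mul_le_add {m r t : ℝ} (ht : 0 < t) :
    r * m / 2 ≤ m ^ 2 * t + r ^ 2 / (8 * t) := by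
  have h8 : 0 < 8 * t := by positivity
  have ht0 : t ≠ 0 := ht.ne'
  rw [show m ^ 2 * t + r ^ 2 / (8 * t) = (m ^ 2 * t * (8 * t) + r ^ 2) / (8 * t) by
    field_simp]
  rw [le_div_iff₀ h8]
  nlinarith [sq_nonneg (m * t - r / 4), sq_nonneg r]

variable {E : Type*} [NormedAddCommGroup E] [InnerProductSpace ℝ E]

/-- **The AM–GM step of the proof of Lemma 4.1**: for `t > 0`,
`e^{−m²t} p_t(x) ≤ e^{−‖x‖m/2} · (4πt)^{−d/2} e^{−‖x‖²/(8t)}` (half of the Gaussian exponent is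
spent on the mass decay, half is kept). [cite: Chatterjee2026YMHiggs, §4.1 (proof of Lemma 4.1, the AM–GM display)] -/
theorem expHeatKernel_le (m : ℝ) (x : E) {t : ℝ} (ht : 0 < t) :
    Real.exp (-m ^ 2 * t) * heatKernel t x ≤
      Real.exp (-(‖x‖ * m / 2)) *
        ((4 * Real.pi * t) ^ (-(Module.finrank ℝ E : ℝ) / 2) * Real.exp (-‖x‖ ^ 2 / (8 * t))) := by
  unfold heatKernel
  have hA : 0 ≤ (4 * Real.pi * t) ^ (-(Module.finrank ℝ E : ℝ) / 2) :=
    Real.rpow_nonneg (by positivity) _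
  have key : Real.exp (-m ^ 2 * t) * Real.exp (-‖x‖ ^ 2 / (4 * t)) ≤
      Real.exp (-(‖x‖ * m / 2)) * Real.exp (-‖x‖ ^ 2 / (8 * t)) := by
    rw [← Real.exp_add, ← Real.exp_add]
    apply Real.exp_le_exp.2
    have h := half_mul_le_add (m := m) (r := ‖x‖) ht
    have hsplit : -‖x‖ ^ 2 / (4 * t) = -‖x‖ ^ 2 / (8 * t) + -‖x‖ ^ 2 / (8 * t) := by ring
    rw [hsplit]
    have : -‖x‖ ^ 2 / (8 * t) = -(‖x‖ ^ 2 / (8 * t)) := by ring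
    rw [this]
    linarith
  calc Real.exp (-m ^ 2 * t) *
        ((4 * Real.pi * t) ^ (-(Module.finrank ℝ E : ℝ) / 2) * Real.exp (-‖x‖ ^ 2 / (4 * t)))
      = (4 * Real.pi * t) ^ (-(Module.finrank ℝ E : ℝ) / 2) *
          (Real.exp (-m ^ 2 * t) * Real.exp (-‖x‖ ^ 2 / (4 * t))) := by ring
    _ ≤ (4 * Real.pi * t) ^ (-(Module.finrank ℝ E : ℝ) / 2) *
          (Real.exp (-(‖x‖ * m / 2)) * Real.exp (-‖x‖ ^ 2 / (8 * t))) :=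
        mul_le_mul_of_nonneg_left key hA
    _ = _ := by ring

/-! ### The reference integral `C(d) = ∫₀^∞ (4πu)^{−d/2} e^{−1/(8u)} du` -/

/-- The reference integrand `(4πu)^{−n/2} e^{−1/(8u)}` is continuous on `(0, ∞)`. [folklore] -/
private theorem continuousOn_refKernel (n : ℕ) :
    ContinuousOn (fun u : ℝ => (4 * Real.pi * u) ^ (-(n : ℝ) / 2) * Real.exp (-1 / (8 * u)))
      (Ioi 0) := by
  refine ContinuousOn.mul ?_ ?_
  · exact (continuousOn_const.mul continuousOn_id).rpow_const fun u hu =>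
      Or.inl (mul_pos (by positivity) (mem_Ioi.1 hu)).ne'
  · exact (continuousOn_const.div (continuousOn_const.mul continuousOn_id)
      fun u hu => (mul_pos (by norm_num : (0 : ℝ) < 8) (mem_Ioi.1 hu)).ne').rexp

/-- **Finiteness of the constant** `C(d)`: for `n ≥ 3` the reference integrand
`(4πu)^{−n/2} e^{−1/(8u)}` is integrable on `(0, ∞)` — bounded near `0` (`e^{−y} ≤ n!/yⁿ`),
`O(u^{−n/2})` with `n/2 > 1` at infinity ("It is easy to see that the above integral is finite,
since `d ≥ 3`"). [cite: Chatterjee2026YMHiggs, §4.1 (proof of Lemma 4.1, case d ≥ 3)] -/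
theorem integrableOn_refKernel {n : ℕ} (hn : 3 ≤ n) :
    IntegrableOn (fun u : ℝ => (4 * Real.pi * u) ^ (-(n : ℝ) / 2) * Real.exp (-1 / (8 * u)))
      (Ioi 0) := by
  have hcont := continuousOn_refKernel n
  have h4π : (0 : ℝ) < 4 * Real.pi := by positivity
  rw [← Ioc_union_Ioi_eq_Ioi zero_le_one]
  refine IntegrableOn.union ?_ ?_
  · -- bounded on `(0, 1]`
    have hmeas : AEStronglyMeasurable
        (fun u : ℝ => (4 * Real.pi * u) ^ (-(n : ℝ) / 2) * Real.exp (-1 / (8 * u)))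
        (volume.restrict (Ioc 0 1)) :=
      (hcont.mono Ioc_subset_Ioi_self).aestronglyMeasurable measurableSet_Ioc
    haveI : IsFiniteMeasure (volume.restrict (Ioc (0 : ℝ) 1)) :=
      isFiniteMeasure_restrict.2 measure_Ioc_lt_top.ne
    refine Integrable.mono'
      (integrable_const ((4 * Real.pi) ^ (-(n : ℝ) / 2) * (n.factorial * 8 ^ n))) hmeas ?_
    refine (ae_restrict_iff' measurableSet_Ioc).2 (ae_of_all _ fun u hu => ?_)
    obtain ⟨hu0, hu1⟩ := hu
    have hu0' : u ≠ 0 := hu0.ne'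
    rw [Real.norm_eq_abs, abs_of_nonneg (mul_nonneg (Real.rpow_nonneg (by positivity) _)
      (Real.exp_pos _).le)]
    -- `(4πu)^{-n/2} ≤ (4π)^{-n/2} u^{-n}` on `(0, 1]`
    have hA : (4 * Real.pi * u) ^ (-(n : ℝ) / 2) ≤
        (4 * Real.pi) ^ (-(n : ℝ) / 2) * u ^ (-(n : ℝ)) := by
      rw [Real.mul_rpow h4π.le hu0.le]
      refine mul_le_mul_of_nonneg_left ?_ (Real.rpow_nonneg h4π.le _)
      refine Real.rpow_le_rpow_of_exponent_ge hu0 hu1 ?_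
      have : (0 : ℝ) ≤ n := Nat.cast_nonneg n
      linarith
    -- `e^{-1/(8u)} ≤ n! (8u)^n`
    have hy : 0 < 1 / (8 * u) := by positivity
    have hB : Real.exp (-1 / (8 * u)) ≤ n.factorial * (8 * u) ^ n := by
      have h1 := Real.pow_div_factorial_le_exp (1 / (8 * u)) hy.le n
      have hpos : 0 < (1 / (8 * u)) ^ n / n.factorial := by positivity
      calc Real.exp (-1 / (8 * u)) = (Real.exp (1 / (8 * u)))⁻¹ := by
            rw [← Real.exp_neg, neg_div]
        _ ≤ ((1 / (8 * u)) ^ n / n.factorial)⁻¹ := inv_anti₀ hpos h1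
        _ = n.factorial * (8 * u) ^ n := by
            rw [one_div, inv_pow, inv_div, div_inv_eq_mul]
    have hC : u ^ (-(n : ℝ)) * (8 * u) ^ n = 8 ^ n := by
      rw [Real.rpow_neg hu0.le, Real.rpow_natCast, mul_pow]
      field_simp
    calc (4 * Real.pi * u) ^ (-(n : ℝ) / 2) * Real.exp (-1 / (8 * u))
        ≤ ((4 * Real.pi) ^ (-(n : ℝ) / 2) * u ^ (-(n : ℝ))) * (n.factorial * (8 * u) ^ n) :=
          mul_le_mul hA hB (Real.exp_pos _).le
            (mul_nonneg (Real.rpow_nonneg h4π.le _) (Real.rpow_nonneg hu0.le _))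
      _ = (4 * Real.pi) ^ (-(n : ℝ) / 2) * (n.factorial * (u ^ (-(n : ℝ)) * (8 * u) ^ n)) := by
          ring
      _ = (4 * Real.pi) ^ (-(n : ℝ) / 2) * (n.factorial * 8 ^ n) := by rw [hC]
  · -- `O(u^{-n/2})` on `(1, ∞)`
    have hmeas : AEStronglyMeasurable
        (fun u : ℝ => (4 * Real.pi * u) ^ (-(n : ℝ) / 2) * Real.exp (-1 / (8 * u)))
        (volume.restrict (Ioi 1)) :=
      (hcont.mono (Ioi_subset_Ioi zero_le_one)).aestronglyMeasurable measurableSet_Ioi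
    have hlt : -(n : ℝ) / 2 < -1 := by
      have : (3 : ℝ) ≤ n := by exact_mod_cast hn
      linarith
    have hdom : IntegrableOn (fun u : ℝ => (4 * Real.pi) ^ (-(n : ℝ) / 2) * u ^ (-(n : ℝ) / 2))
        (Ioi 1) :=
      Integrable.const_mul (integrableOn_Ioi_rpow_of_lt hlt one_pos) _
    refine Integrable.mono' hdom hmeas
      ((ae_restrict_iff' measurableSet_Ioi).2 (ae_of_all _ fun u hu => ?_))
    have hu0 : 0 < u := lt_trans one_pos (mem_Ioi.1 hu)
    rw [Real.norm_eq_abs, abs_of_nonneg (mul_nonneg (Real.rpow_nonneg (by positivity) _)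
      (Real.exp_pos _).le), Real.mul_rpow h4π.le hu0.le]
    refine mul_le_of_le_one_right
      (mul_nonneg (Real.rpow_nonneg h4π.le _) (Real.rpow_nonneg hu0.le _)) ?_
    rw [Real.exp_le_one_iff, div_nonpos_iff]
    exact Or.inr ⟨by norm_num, by positivity⟩

/-! ### Lemma 4.1, case `d ≥ 3` -/

/-- **Lemma 4.1, case `d ≥ 3`** (Chatterjee), PROVED: there is `C` (depending only on
`d = finrank ℝ E`; here `C = ∫₀^∞ (4πu)^{−d/2} e^{−1/(8u)} du`) such that for every `m > 0` and
`x ≠ 0`,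
`K_m(x) = ∫₀^∞ e^{−m²t} p_t(x) dt ≤ C e^{−‖x‖ m/2} ‖x‖^{−(d−2)}` —
*printed:* "`K_λ(x) ≤ C(d) e^{−‖x‖√λ/2} ‖x‖^{−(d−2)}` if `d ≥ 3`", `√λ = m`. This is the first clause
of the named fact `kernelK_upperBound`. Proof as in print: AM–GM (`expHeatKernel_le`), then the
scaling `t = ‖x‖² u`
(`integral_comp_mul_left_Ioi`) in place of the printed `s = ‖x‖²/(4t)`.
[cite: Chatterjee2026YMHiggs, Lemma 4.1 (§4.1), case d ≥ 3; proof ibid.] -/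
theorem kernelK_le_of_three_le [FiniteDimensional ℝ E] [MeasurableSpace E] [BorelSpace E]
    (h3 : 3 ≤ Module.finrank ℝ E) :
    ∃ C : ℝ, ∀ (m : ℝ), 0 < m → ∀ x : E, x ≠ 0 →
      ∫ t in Ioi (0 : ℝ), Real.exp (-m ^ 2 * t) * heatKernel t x ≤
        C * Real.exp (-(‖x‖ * m / 2)) * ‖x‖ ^ (-((Module.finrank ℝ E : ℝ) - 2)) := by
  refine ⟨∫ u in Ioi (0 : ℝ),
    (4 * Real.pi * u) ^ (-(Module.finrank ℝ E : ℝ) / 2) * Real.exp (-1 / (8 * u)), ?_⟩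
  intro m _ x hx
  have hr : 0 < ‖x‖ := norm_pos_iff.2 hx
  have hr0 : ‖x‖ ≠ 0 := hr.ne'
  have hr2 : 0 < ‖x‖ ^ 2 := by positivity
  have h4π : (0 : ℝ) < 4 * Real.pi := by positivity
  -- the comparison integrand after AM–GM
  set G : ℝ → ℝ := fun t =>
    (4 * Real.pi * t) ^ (-(Module.finrank ℝ E : ℝ) / 2) * Real.exp (-‖x‖ ^ 2 / (8 * t)) with hGdef
  -- scaling: `G (‖x‖² u) = (‖x‖²)^{-d/2} · refKernel u` on `(0, ∞)`
  have hG : ∀ u ∈ Ioi (0 : ℝ), G (‖x‖ ^ 2 * u) =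
      (‖x‖ ^ 2) ^ (-(Module.finrank ℝ E : ℝ) / 2) *
        ((4 * Real.pi * u) ^ (-(Module.finrank ℝ E : ℝ) / 2) * Real.exp (-1 / (8 * u))) := by
    intro u hu
    have hu0 : 0 < u := mem_Ioi.1 hu
    have hu0' : u ≠ 0 := hu0.ne'
    simp only [hGdef]
    rw [show 4 * Real.pi * (‖x‖ ^ 2 * u) = ‖x‖ ^ 2 * (4 * Real.pi * u) by ring,
      Real.mul_rpow hr2.le (by positivity : (0 : ℝ) ≤ 4 * Real.pi * u),
      show -‖x‖ ^ 2 / (8 * (‖x‖ ^ 2 * u)) = -1 / (8 * u) by field_simp]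
    ring
  -- integrability of `G` on `(0, ∞)` from that of the reference kernel
  have hcm : IntegrableOn (fun u : ℝ => (‖x‖ ^ 2) ^ (-(Module.finrank ℝ E : ℝ) / 2) *
      ((4 * Real.pi * u) ^ (-(Module.finrank ℝ E : ℝ) / 2) * Real.exp (-1 / (8 * u)))) (Ioi 0) :=
    Integrable.const_mul (integrableOn_refKernel h3) _
  have hGs : IntegrableOn (fun u => G (‖x‖ ^ 2 * u)) (Ioi 0) :=
    IntegrableOn.congr_fun hcm (fun u hu => (hG u hu).symm) measurableSet_Ioi
  have hGint : IntegrableOn G (Ioi 0) := by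
    have h := (integrableOn_Ioi_comp_mul_left_iff G 0 hr2).1 hGs
    simpa only [mul_zero] using h
  -- the value of `∫ G` by scaling
  have hGval : ∫ t in Ioi (0 : ℝ), G t =
      ‖x‖ ^ (-((Module.finrank ℝ E : ℝ) - 2)) *
        ∫ u in Ioi (0 : ℝ), (4 * Real.pi * u) ^ (-(Module.finrank ℝ E : ℝ) / 2) *
          Real.exp (-1 / (8 * u)) := by
    have hcomp := integral_comp_mul_left_Ioi G 0 hr2
    simp only [mul_zero, smul_eq_mul] at hcomp
    rw [setIntegral_congr_fun measurableSet_Ioi hG, integral_const_mul] at hcomp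
    -- `hcomp : (‖x‖²)^{-d/2} * C = (‖x‖²)⁻¹ * ∫ G`
    have hpow : ‖x‖ ^ 2 * (‖x‖ ^ 2) ^ (-(Module.finrank ℝ E : ℝ) / 2) =
        ‖x‖ ^ (-((Module.finrank ℝ E : ℝ) - 2)) := by
      rw [show (‖x‖ ^ 2 : ℝ) = ‖x‖ ^ (2 : ℝ) by rw [Real.rpow_two], ← Real.rpow_mul hr.le,
        ← Real.rpow_add hr]
      congr 1
      ring
    calc ∫ t in Ioi (0 : ℝ), G t
        = ‖x‖ ^ 2 * ((‖x‖ ^ 2)⁻¹ * ∫ t in Ioi (0 : ℝ), G t) := by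
          rw [← mul_assoc, mul_inv_cancel₀ hr2.ne', one_mul]
      _ = ‖x‖ ^ 2 * ((‖x‖ ^ 2) ^ (-(Module.finrank ℝ E : ℝ) / 2) *
            ∫ u in Ioi (0 : ℝ), (4 * Real.pi * u) ^ (-(Module.finrank ℝ E : ℝ) / 2) *
              Real.exp (-1 / (8 * u))) := by rw [hcomp]
      _ = _ := by rw [← mul_assoc, hpow]
  -- AM–GM under the integral
  have hmono : ∫ t in Ioi (0 : ℝ), Real.exp (-m ^ 2 * t) * heatKernel t x ≤
      ∫ t in Ioi (0 : ℝ), Real.exp (-(‖x‖ * m / 2)) * G t := by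
    refine integral_mono_of_nonneg ?_ (hGint.const_mul _) ?_
    · exact (ae_restrict_iff' measurableSet_Ioi).2 (ae_of_all _ fun t ht =>
        mul_nonneg (Real.exp_pos _).le (heatKernel_pos (mem_Ioi.1 ht) x).le)
    · exact (ae_restrict_iff' measurableSet_Ioi).2 (ae_of_all _ fun t ht =>
        expHeatKernel_le m x (mem_Ioi.1 ht))
  calc ∫ t in Ioi (0 : ℝ), Real.exp (-m ^ 2 * t) * heatKernel t x
      ≤ ∫ t in Ioi (0 : ℝ), Real.exp (-(‖x‖ * m / 2)) * G t := hmono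
    _ = Real.exp (-(‖x‖ * m / 2)) * ∫ t in Ioi (0 : ℝ), G t := integral_const_mul _ _
    _ = _ := by rw [hGval]; ring

/-! ### Lemma 4.1, case `d = 2` -/

/-- AM–GM with half the mass term: `‖x‖ m/2 ≤ (m²/2) t + ‖x‖²/(8t)` for `t > 0`
(`4m²t² − 4rmt + r² = (2mt − r)² ≥ 0`). [folklore] -/
private theorem half_mul_le_add' {m r t : ℝ} (ht : 0 < t) :
    r * m / 2 ≤ m ^ 2 / 2 * t + r ^ 2 / (8 * t) := by
  have h8 : 0 < 8 * t := by positivity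
  have ht0 : t ≠ 0 := ht.ne'
  rw [show m ^ 2 / 2 * t + r ^ 2 / (8 * t) = (4 * m ^ 2 * t ^ 2 + r ^ 2) / (8 * t) by
    field_simp; ring]
  rw [le_div_iff₀ h8]
  nlinarith [sq_nonneg (2 * m * t - r)]

/-- `t⁻¹ e^{−a/t} ≤ (t + a)⁻¹` for `t > 0`, `a ≥ 0` (from `1 + a/t ≤ e^{a/t}`). [folklore] -/
private theorem inv_mul_exp_neg_div_le {a t : ℝ} (ha : 0 ≤ a) (ht : 0 < t) :
    t⁻¹ * Real.exp (-a / t) ≤ (t + a)⁻¹ := by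
  have ht0 : t ≠ 0 := ht.ne'
  have h1 : a / t + 1 ≤ Real.exp (a / t) := Real.add_one_le_exp _
  have hpos : 0 < a / t + 1 := by positivity
  have h2 : Real.exp (-a / t) ≤ (a / t + 1)⁻¹ := by
    rw [neg_div, Real.exp_neg]
    exact inv_anti₀ hpos h1
  calc t⁻¹ * Real.exp (-a / t) ≤ t⁻¹ * (a / t + 1)⁻¹ :=
        mul_le_mul_of_nonneg_left h2 (inv_nonneg.2 ht.le)
    _ = (t + a)⁻¹ := by
        rw [← mul_inv]
        congr 1
        field_simp
        ring

/-- **The AM–GM step in two dimensions**: for `d = 2`, `t > 0`,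
`e^{−m²t} p_t(x) ≤ e^{−‖x‖m/2} (4π)⁻¹ · (t + ‖x‖²/8)⁻¹ e^{−(m²/2)t}` — half of the mass term and
half of the Gaussian exponent give the decay `e^{−‖x‖m/2}`, and `t⁻¹e^{−‖x‖²/(8t)} ≤ (t + ‖x‖²/8)⁻¹`
(print: "by an application of the AM–GM inequality similar to the above, we get
`K_λ(x) ≤ e^{−‖x‖√λ/4} ∫₀^∞ (4πt)⁻¹ exp(−‖x‖²/(8t) − λt/2) dt`").
[cite: Chatterjee2026YMHiggs, §4.1 (proof of Lemma 4.1, case d = 2)] -/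
theorem expHeatKernel_le_two (h2 : Module.finrank ℝ E = 2) (m : ℝ) (x : E) {t : ℝ}
    (ht : 0 < t) :
    Real.exp (-m ^ 2 * t) * heatKernel t x ≤
      Real.exp (-(‖x‖ * m / 2)) * (4 * Real.pi)⁻¹ *
        ((t + ‖x‖ ^ 2 / 8)⁻¹ * Real.exp (-(m ^ 2 / 2) * t)) := by
  unfold heatKernel
  rw [h2, show (-((2 : ℕ) : ℝ) / 2 : ℝ) = -1 by norm_num, Real.rpow_neg_one]
  have ht0 : t ≠ 0 := ht.ne'
  have hexp : Real.exp (-m ^ 2 * t) * Real.exp (-‖x‖ ^ 2 / (4 * t)) ≤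
      Real.exp (-(‖x‖ * m / 2)) *
        (Real.exp (-(m ^ 2 / 2) * t) * Real.exp (-(‖x‖ ^ 2 / 8) / t)) := by
    rw [← Real.exp_add, ← Real.exp_add, ← Real.exp_add]
    apply Real.exp_le_exp.2
    have h := half_mul_le_add' (m := m) (r := ‖x‖) ht
    have e1 : -‖x‖ ^ 2 / (4 * t) = -(‖x‖ ^ 2 / (8 * t)) + -(‖x‖ ^ 2 / (8 * t)) := by ring
    have e2 : -(‖x‖ ^ 2 / 8) / t = -(‖x‖ ^ 2 / (8 * t)) := by ring
    rw [e1, e2]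
    linarith
  have hinv : t⁻¹ * Real.exp (-(‖x‖ ^ 2 / 8) / t) ≤ (t + ‖x‖ ^ 2 / 8)⁻¹ :=
    inv_mul_exp_neg_div_le (by positivity) ht
  calc Real.exp (-m ^ 2 * t) * ((4 * Real.pi * t)⁻¹ * Real.exp (-‖x‖ ^ 2 / (4 * t)))
      = (4 * Real.pi)⁻¹ * t⁻¹ * (Real.exp (-m ^ 2 * t) * Real.exp (-‖x‖ ^ 2 / (4 * t))) := by
        rw [mul_inv]; ring
    _ ≤ (4 * Real.pi)⁻¹ * t⁻¹ * (Real.exp (-(‖x‖ * m / 2)) *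
          (Real.exp (-(m ^ 2 / 2) * t) * Real.exp (-(‖x‖ ^ 2 / 8) / t))) :=
        mul_le_mul_of_nonneg_left hexp (by positivity)
    _ = Real.exp (-(‖x‖ * m / 2)) * (4 * Real.pi)⁻¹ *
          (Real.exp (-(m ^ 2 / 2) * t) * (t⁻¹ * Real.exp (-(‖x‖ ^ 2 / 8) / t))) := by ring
    _ ≤ Real.exp (-(‖x‖ * m / 2)) * (4 * Real.pi)⁻¹ *
          (Real.exp (-(m ^ 2 / 2) * t) * (t + ‖x‖ ^ 2 / 8)⁻¹) :=
        mul_le_mul_of_nonneg_left (mul_le_mul_of_nonneg_left hinv (Real.exp_pos _).le)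
          (by positivity)
    _ = _ := by ring

/-- **The comparison integral in two dimensions**: for `a, b > 0` the function
`(t + a)⁻¹ e^{−bt}` is integrable on `(0, ∞)` and
`∫₀^∞ (t + a)⁻¹ e^{−bt} dt ≤ log(1 + 1/a) + 1/b` (split at `t = 1`: `∫₀¹ (t + a)⁻¹ dt = log((1 + a)/a)`,
`∫₁^∞ e^{−bt} dt ≤ 1/b`) — the tree's form of the printed splitting of `∫₀^∞ (4πt)⁻¹
exp(−‖x‖²/(8t) − λt/2) dt` into a bounded part and a logarithmic part.
[cite: Chatterjee2026YMHiggs, §4.1 (proof of Lemma 4.1, case d = 2: the two parts of the integral)] -/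
theorem integral_inv_add_mul_exp_le {a b : ℝ} (ha : 0 < a) (hb : 0 < b) :
    IntegrableOn (fun t : ℝ => (t + a)⁻¹ * Real.exp (-b * t)) (Ioi 0) ∧
      ∫ t in Ioi (0 : ℝ), (t + a)⁻¹ * Real.exp (-b * t) ≤ Real.log (1 + a⁻¹) + b⁻¹ := by
  have hcont : ContinuousOn (fun t : ℝ => (t + a)⁻¹ * Real.exp (-b * t)) (Ici 0) := by
    refine ContinuousOn.mul ?_ (Real.continuous_exp.comp (continuous_const.mul continuous_id)).continuousOn
    exact (continuousOn_id.add continuousOn_const).inv₀ fun t ht =>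
      (add_pos_of_nonneg_of_pos (mem_Ici.1 ht) ha).ne'
  -- integrability on `(0, 1]`: bounded by `a⁻¹`
  have hF1 : IntegrableOn (fun t : ℝ => (t + a)⁻¹ * Real.exp (-b * t)) (Ioc 0 1) := by
    have hmeas : AEStronglyMeasurable (fun t : ℝ => (t + a)⁻¹ * Real.exp (-b * t))
        (volume.restrict (Ioc 0 1)) :=
      (hcont.mono fun t ht => mem_Ici.2 ht.1.le).aestronglyMeasurable measurableSet_Ioc
    haveI : IsFiniteMeasure (volume.restrict (Ioc (0 : ℝ) 1)) :=
      isFiniteMeasure_restrict.2 measure_Ioc_lt_top.ne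
    refine Integrable.mono' (integrable_const a⁻¹) hmeas
      ((ae_restrict_iff' measurableSet_Ioc).2 (ae_of_all _ fun t ht => ?_))
    have ht0 : 0 < t := ht.1
    rw [Real.norm_eq_abs, abs_of_nonneg (mul_nonneg (inv_nonneg.2 (by positivity))
      (Real.exp_pos _).le)]
    calc (t + a)⁻¹ * Real.exp (-b * t) ≤ (t + a)⁻¹ :=
          mul_le_of_le_one_right (inv_nonneg.2 (by positivity))
            (Real.exp_le_one_iff.2 (by nlinarith))
      _ ≤ a⁻¹ := inv_anti₀ ha (by linarith)
  -- integrability on `(1, ∞)`: dominated by `e^{−bt}`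
  have hF2 : IntegrableOn (fun t : ℝ => (t + a)⁻¹ * Real.exp (-b * t)) (Ioi 1) := by
    have hmeas : AEStronglyMeasurable (fun t : ℝ => (t + a)⁻¹ * Real.exp (-b * t))
        (volume.restrict (Ioi 1)) :=
      (hcont.mono fun t ht => mem_Ici.2 (zero_le_one.trans (mem_Ioi.1 ht).le)).aestronglyMeasurable
        measurableSet_Ioi
    refine Integrable.mono' (exp_neg_integrableOn_Ioi 1 hb) hmeas
      ((ae_restrict_iff' measurableSet_Ioi).2 (ae_of_all _ fun t ht => ?_))
    have ht1 : 1 < t := mem_Ioi.1 ht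
    rw [Real.norm_eq_abs, abs_of_nonneg (mul_nonneg (inv_nonneg.2 (by positivity))
      (Real.exp_pos _).le)]
    exact mul_le_of_le_one_left (Real.exp_pos _).le (inv_le_one_of_one_le₀ (by linarith))
  have hF : IntegrableOn (fun t : ℝ => (t + a)⁻¹ * Real.exp (-b * t)) (Ioi 0) := by
    rw [← Ioc_union_Ioi_eq_Ioi zero_le_one]
    exact hF1.union hF2
  refine ⟨hF, ?_⟩
  have hdisj : Disjoint (Ioc (0 : ℝ) 1) (Ioi 1) :=
    Set.disjoint_left.2 fun t ht ht' => not_lt.2 ht.2 (mem_Ioi.1 ht')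
  rw [← Ioc_union_Ioi_eq_Ioi zero_le_one, setIntegral_union hdisj measurableSet_Ioi hF1 hF2]
  -- `∫₀¹ (t + a)⁻¹ e^{−bt} ≤ ∫₀¹ (t + a)⁻¹ = log (1 + a⁻¹)`
  have hG1 : IntegrableOn (fun t : ℝ => (t + a)⁻¹) (Ioc 0 1) := by
    refine (ContinuousOn.integrableOn_compact isCompact_Icc ?_).mono_set Ioc_subset_Icc_self
    exact (continuousOn_id.add continuousOn_const).inv₀ fun t ht =>
      (add_pos_of_nonneg_of_pos ht.1 ha).ne'
  have h1 : ∫ t in Ioc (0 : ℝ) 1, (t + a)⁻¹ * Real.exp (-b * t) ≤ Real.log (1 + a⁻¹) := by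
    have hval : ∫ t in Ioc (0 : ℝ) 1, (t + a)⁻¹ = Real.log (1 + a⁻¹) := by
      rw [← intervalIntegral.integral_of_le zero_le_one,
        intervalIntegral.integral_comp_add_right (fun s : ℝ => s⁻¹) a, zero_add,
        integral_inv_of_pos ha (by linarith)]
      congr 1
      field_simp
      ring
    rw [← hval]
    refine setIntegral_mono_on hF1 hG1 measurableSet_Ioc fun t ht => ?_
    exact mul_le_of_le_one_right (inv_nonneg.2 (by linarith [ht.1]))
      (Real.exp_le_one_iff.2 (by nlinarith [ht.1]))
  -- `∫₁^∞ (t + a)⁻¹ e^{−bt} ≤ ∫₁^∞ e^{−bt} ≤ 1/b`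
  have h2 : ∫ t in Ioi (1 : ℝ), (t + a)⁻¹ * Real.exp (-b * t) ≤ b⁻¹ := by
    have hle : ∫ t in Ioi (1 : ℝ), (t + a)⁻¹ * Real.exp (-b * t) ≤
        ∫ t in Ioi (1 : ℝ), Real.exp (-b * t) :=
      setIntegral_mono_on hF2 (exp_neg_integrableOn_Ioi 1 hb) measurableSet_Ioi fun t ht =>
        mul_le_of_le_one_left (Real.exp_pos _).le
          (inv_le_one_of_one_le₀ (by linarith [mem_Ioi.1 ht]))
    refine hle.trans ?_
    rw [integral_exp_mul_Ioi (by linarith : -b < 0) 1, neg_div_neg_eq, mul_one,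
      div_le_iff₀ hb, inv_mul_cancel₀ hb.ne']
    exact Real.exp_le_one_iff.2 (by linarith)
  linarith

/-- **Lemma 4.1, case `d = 2`** (Chatterjee), PROVED with constant `1`: for `finrank ℝ E = 2`,
`m > 0`, `x ≠ 0`, `K_m(x) ≤ e^{−‖x‖m/4}(1 + m⁻²)` if `‖x‖ ≥ 2m` and
`K_m(x) ≤ e^{−‖x‖m/4}(m⁻² + log(2m/‖x‖))` if `‖x‖ < 2m` — *printed:* "`≤ C(d) e^{−‖x‖√λ/4}(1 + λ⁻¹)`
if `d = 2` and `‖x‖ ≥ 2√λ`; `≤ C(d) e^{−‖x‖√λ/4}(λ⁻¹ + log(2√λ/‖x‖))` if `d = 2` and `‖x‖ < 2√λ`"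
(`λ = m²`). From `expHeatKernel_le_two` and `integral_inv_add_mul_exp_le`:
`K ≤ e^{−‖x‖m/2}(4π)⁻¹ (log(1 + 8/‖x‖²) + 2/m²)`, then `log(1 + 8/r²) ≤ 8/r² ≤ 2/m²` for `r ≥ 2m`,
and `1 + 8/r² ≤ (1 + 8/m²)(2m/r)²` for `r < 2m`. [cite: Chatterjee2026YMHiggs, Lemma 4.1 (§4.1), case d = 2; proof ibid.] -/
theorem kernelK_le_of_finrank_eq_two [FiniteDimensional ℝ E] [MeasurableSpace E] [BorelSpace E]
    (h2 : Module.finrank ℝ E = 2) {m : ℝ} (hm : 0 < m) {x : E} (hx : x ≠ 0) :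
    (2 * m ≤ ‖x‖ → ∫ t in Ioi (0 : ℝ), Real.exp (-m ^ 2 * t) * heatKernel t x ≤
        Real.exp (-(‖x‖ * m / 4)) * (1 + (m ^ 2)⁻¹)) ∧
    (‖x‖ < 2 * m → ∫ t in Ioi (0 : ℝ), Real.exp (-m ^ 2 * t) * heatKernel t x ≤
        Real.exp (-(‖x‖ * m / 4)) * ((m ^ 2)⁻¹ + Real.log (2 * m / ‖x‖))) := by
  have hr : 0 < ‖x‖ := norm_pos_iff.2 hx
  have hr0 : ‖x‖ ≠ 0 := hr.ne'
  have hm0 : m ≠ 0 := hm.ne'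
  have ha : 0 < ‖x‖ ^ 2 / 8 := by positivity
  have hb : 0 < m ^ 2 / 2 := by positivity
  have h4π : (0 : ℝ) < 4 * Real.pi := by positivity
  obtain ⟨hFint, hFle⟩ := integral_inv_add_mul_exp_le ha hb
  -- the main estimate
  have hK : ∫ t in Ioi (0 : ℝ), Real.exp (-m ^ 2 * t) * heatKernel t x ≤
      Real.exp (-(‖x‖ * m / 2)) * (4 * Real.pi)⁻¹ *
        (Real.log (1 + (‖x‖ ^ 2 / 8)⁻¹) + (m ^ 2 / 2)⁻¹) := by
    calc ∫ t in Ioi (0 : ℝ), Real.exp (-m ^ 2 * t) * heatKernel t x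
        ≤ ∫ t in Ioi (0 : ℝ), Real.exp (-(‖x‖ * m / 2)) * (4 * Real.pi)⁻¹ *
            ((t + ‖x‖ ^ 2 / 8)⁻¹ * Real.exp (-(m ^ 2 / 2) * t)) := by
          refine integral_mono_of_nonneg ?_ (hFint.const_mul _) ?_
          · exact (ae_restrict_iff' measurableSet_Ioi).2 (ae_of_all _ fun t ht =>
              mul_nonneg (Real.exp_pos _).le (heatKernel_pos (mem_Ioi.1 ht) x).le)
          · exact (ae_restrict_iff' measurableSet_Ioi).2 (ae_of_all _ fun t ht =>
              expHeatKernel_le_two h2 m x (mem_Ioi.1 ht))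
      _ = Real.exp (-(‖x‖ * m / 2)) * (4 * Real.pi)⁻¹ *
            ∫ t in Ioi (0 : ℝ), (t + ‖x‖ ^ 2 / 8)⁻¹ * Real.exp (-(m ^ 2 / 2) * t) :=
          integral_const_mul _ _
      _ ≤ _ := mul_le_mul_of_nonneg_left hFle (by positivity)
  have hexp : Real.exp (-(‖x‖ * m / 2)) ≤ Real.exp (-(‖x‖ * m / 4)) :=
    Real.exp_le_exp.2 (by nlinarith [mul_pos hr hm])
  have hbinv : (m ^ 2 / 2)⁻¹ = 2 * (m ^ 2)⁻¹ := by rw [inv_div, div_eq_mul_inv]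
  have hainv : (‖x‖ ^ 2 / 8)⁻¹ = 8 / ‖x‖ ^ 2 := inv_div _ _
  have hπ10 : (4 * Real.pi)⁻¹ * 10 ≤ 1 := by
    rw [inv_mul_le_iff₀ h4π]
    linarith [Real.pi_gt_three]
  have hlog0 : 0 ≤ Real.log (1 + (‖x‖ ^ 2 / 8)⁻¹) :=
    Real.log_nonneg (le_add_of_nonneg_right (inv_nonneg.2 ha.le))
  constructor
  · intro hle
    -- `log (1 + 8/r²) ≤ 8/r² ≤ 2/m²`
    have hsq : m ^ 2 / 2 ≤ ‖x‖ ^ 2 / 8 := by nlinarith [pow_le_pow_left₀ (by positivity) hle 2]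
    have hlog : Real.log (1 + (‖x‖ ^ 2 / 8)⁻¹) ≤ 2 * (m ^ 2)⁻¹ := by
      have hl := Real.log_le_sub_one_of_pos (by positivity : 0 < 1 + (‖x‖ ^ 2 / 8)⁻¹)
      have hi : (‖x‖ ^ 2 / 8)⁻¹ ≤ (m ^ 2 / 2)⁻¹ := inv_anti₀ hb hsq
      linarith
    calc ∫ t in Ioi (0 : ℝ), Real.exp (-m ^ 2 * t) * heatKernel t x
        ≤ Real.exp (-(‖x‖ * m / 2)) * (4 * Real.pi)⁻¹ *
            (Real.log (1 + (‖x‖ ^ 2 / 8)⁻¹) + (m ^ 2 / 2)⁻¹) := hK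
      _ ≤ Real.exp (-(‖x‖ * m / 4)) * (4 * Real.pi)⁻¹ * (2 * (m ^ 2)⁻¹ + 2 * (m ^ 2)⁻¹) := by
          rw [hbinv]
          gcongr
      _ = Real.exp (-(‖x‖ * m / 4)) * ((4 * Real.pi)⁻¹ * 4) * (m ^ 2)⁻¹ := by ring
      _ ≤ Real.exp (-(‖x‖ * m / 4)) * 1 * (m ^ 2)⁻¹ := by
          gcongr
          linarith
      _ ≤ Real.exp (-(‖x‖ * m / 4)) * (1 + (m ^ 2)⁻¹) := by
          rw [mul_one, mul_add, mul_one]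
          linarith [Real.exp_pos (-(‖x‖ * m / 4))]
  · intro hlt
    have hq : 1 ≤ 2 * m / ‖x‖ := (one_le_div hr).2 hlt.le
    have hlogq : 0 ≤ Real.log (2 * m / ‖x‖) := Real.log_nonneg hq
    -- `1 + 8/r² ≤ (1 + 8/m²) (2m/r)²` for `r < 2m`
    have hstep : 1 + (‖x‖ ^ 2 / 8)⁻¹ ≤ (1 + 8 * (m ^ 2)⁻¹) * (2 * m / ‖x‖) ^ 2 := by
      rw [hainv, show (1 + 8 * (m ^ 2)⁻¹) * (2 * m / ‖x‖) ^ 2 = (4 * m ^ 2 + 32) / ‖x‖ ^ 2 by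
        field_simp; ring, show 1 + 8 / ‖x‖ ^ 2 = (‖x‖ ^ 2 + 8) / ‖x‖ ^ 2 by field_simp]
      exact div_le_div_of_nonneg_right (by nlinarith [mul_pos hr hm]) (by positivity)
    have hlog : Real.log (1 + (‖x‖ ^ 2 / 8)⁻¹) ≤ 8 * (m ^ 2)⁻¹ + 2 * Real.log (2 * m / ‖x‖) := by
      have hpos1 : 0 < 1 + 8 * (m ^ 2)⁻¹ := by positivity
      have hpos2 : 0 < (2 * m / ‖x‖) ^ 2 := by positivity
      calc Real.log (1 + (‖x‖ ^ 2 / 8)⁻¹)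
          ≤ Real.log ((1 + 8 * (m ^ 2)⁻¹) * (2 * m / ‖x‖) ^ 2) :=
            Real.log_le_log (by positivity) hstep
        _ = Real.log (1 + 8 * (m ^ 2)⁻¹) + 2 * Real.log (2 * m / ‖x‖) := by
            rw [Real.log_mul hpos1.ne' hpos2.ne', Real.log_pow]
            push_cast
            ring
        _ ≤ 8 * (m ^ 2)⁻¹ + 2 * Real.log (2 * m / ‖x‖) := by
            have hl := Real.log_le_sub_one_of_pos hpos1
            linarith
    calc ∫ t in Ioi (0 : ℝ), Real.exp (-m ^ 2 * t) * heatKernel t x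
        ≤ Real.exp (-(‖x‖ * m / 2)) * (4 * Real.pi)⁻¹ *
            (Real.log (1 + (‖x‖ ^ 2 / 8)⁻¹) + (m ^ 2 / 2)⁻¹) := hK
      _ ≤ Real.exp (-(‖x‖ * m / 4)) * (4 * Real.pi)⁻¹ *
            ((8 * (m ^ 2)⁻¹ + 2 * Real.log (2 * m / ‖x‖)) + 2 * (m ^ 2)⁻¹) := by
          rw [hbinv]
          gcongr
      _ ≤ Real.exp (-(‖x‖ * m / 4)) * (4 * Real.pi)⁻¹ *
            (10 * ((m ^ 2)⁻¹ + Real.log (2 * m / ‖x‖))) := by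
          gcongr
          nlinarith [inv_pos.2 (pow_pos hm 2)]
      _ = Real.exp (-(‖x‖ * m / 4)) * ((4 * Real.pi)⁻¹ * 10) *
            ((m ^ 2)⁻¹ + Real.log (2 * m / ‖x‖)) := by ring
      _ ≤ Real.exp (-(‖x‖ * m / 4)) * 1 * ((m ^ 2)⁻¹ + Real.log (2 * m / ‖x‖)) := by
          gcongr
      _ = _ := by rw [mul_one]

/-! ### The named fact `kernelK_upperBound`, discharged -/

section Discharge

variable (E)
variable [FiniteDimensional ℝ E] [MeasurableSpace E] [BorelSpace E]

/-- **Lemma 4.1** (Chatterjee), PROVED — discharge of the named fact `kernelK_upperBound` of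
`ProcaFieldMass`: there is `C = C(d)` (`d = finrank ℝ E`; the reference integral
`∫₀^∞ (4πu)^{−d/2} e^{−1/(8u)} du` for `d ≥ 3`, `1` for `d = 2`) such that for all `m > 0`, `x ≠ 0`:
`K_m(x) ≤ C e^{−‖x‖m/2} ‖x‖^{−(d−2)}` (`d ≥ 3`); `≤ C e^{−‖x‖m/4}(1 + m⁻²)` (`d = 2`, `‖x‖ ≥ 2m`);
`≤ C e^{−‖x‖m/4}(m⁻² + log(2m/‖x‖))` (`d = 2`, `‖x‖ < 2m`). Assembled from
`kernelK_le_of_three_le` and `kernelK_le_of_finrank_eq_two` (the clauses are vacuous in the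
other dimensions). [cite: Chatterjee2026YMHiggs, Lemma 4.1 (§4.1); proof ibid.] -/
theorem kernelK_upperBound_holds : kernelK_upperBound E := by
  by_cases h3 : 3 ≤ Module.finrank ℝ E
  · obtain ⟨C, hC⟩ := kernelK_le_of_three_le (E := E) h3
    refine ⟨C, fun m hm x hx => ⟨fun _ => hC m hm x hx, fun h2 => absurd h2 (by omega),
      fun h2 => absurd h2 (by omega)⟩⟩
  · by_cases h2 : Module.finrank ℝ E = 2
    · refine ⟨1, fun m hm x hx => ⟨fun h => absurd h h3, fun _ hle => ?_, fun _ hlt => ?_⟩⟩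
      · rw [one_mul]
        exact (kernelK_le_of_finrank_eq_two h2 hm hx).1 hle
      · rw [one_mul]
        exact (kernelK_le_of_finrank_eq_two h2 hm hx).2 hlt
    · exact ⟨0, fun m _ x _ => ⟨fun h => absurd h h3, fun h => absurd h h2, fun h => absurd h h2⟩⟩

end Discharge

end Literature.MathematicalPhysics.QuantumFieldTheory.Chatterjee2026YMHiggs
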